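import Summits.Ventures.QEC.Decoders.HGPPuncturedReedMullerFamily
import HarnessLib

/-!
# The punctured quantum Reed–Muller family `PQRM(m; a, b) = [[2^m − 1, 2^m + 1 − A_a − A_b, 2^{min(a,b)+1} − 1]]`, every `a + b < m`

LADDER-QEC (venture cell `qec`), PARTITION row 08 (qec-type-08 gen 6, «08.PQRM», in the lineage of item 141 «08.QRM»). The CSS
code on the `2^m − 1` NONZERO points of `𝔽₂^m` whose `X`-checks are the shortened generator matrix `Ḡ(a,m)` of `ℛ(a,m)` (the
monomials of degree `1 … a`) and whose `Z`-checks are `Ḡ(b,m)` (`QRM.shortGenMatrix`, `QuantumReedMullerCodesShortened.lean`;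
they commute for every `a + b < m`, `QRM.shortGenMatrix_mul_transpose`). Item 141 F3 typed the EDGE `a + b + 1 = m` (`k = 1`:
Steane `[[7,1,3]]`, `[[15,1,3]]`, ADP14's `[[2^m−1,1,3]]`, `[[127,1,15]]`, …) as `QRM.shortCode`; this file types the whole
two-parameter family (`A_r = Σ_{i≤r} C(m,i)`):

  `PQRM(m; a, b) = [[2^m − 1, 2^m + 1 − A_a − A_b, 2^{min(a,b)+1} − 1]]`   (`a + b < m`; `d_Z = 2^{a+1} − 1`, `d_X = 2^{b+1} − 1`).

At `a = b = 1` this is the quantum HAMMING family `[[2^m − 1, 2^m − 1 − 2m, 3]]` (a third KERNEL route, after Steane-enlargement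
`QuantumHammingCodes.lean` and gen-5's CSS(Hamming) presentation `QuantumHamming.code`); further members `[[31,21,3]]`, `[[63,36,3]]`,
`[[63,21,7]]`, `[[127,71,7]]`, `[[255,183,7]]`, `[[255,71,15]]` (every line kernel-checked below).

* `pqrm m a b (h : a + b < m) : CSSCode (MonoPos m a) (MonoPos m b) (Pt m)` (definition);
* `rmRows_add_rmRows_le` (`A_a + A_b ≤ 2^m` for `a + b < m`), `pqrm_k : k = 2^m + 1 − A_a − A_b`;
* `rowSpace_shortGenMatrix_mono` (degree monotonicity), `pqrm_dZ = 2^{a+1} − 1`, `pqrm_dX = 2^{b+1} − 1` (lower bounds from the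
  punctured Reed–Muller distance `minDist_pcCode_shortGenMatrix` of `HGPPuncturedReedMullerFamily.lean`, witnesses from
  `QRM.exists_logical`);
* ★ `pqrm_isCode (h : a + b < m) : (pqrm m a b h).IsCode (2^m − 1) (2^m + 1 − rmRows m a − rmRows m b) (2^{min a b + 1} − 1)`;
* members: `pqrm_hamming (hm : 3 ≤ m) : [[2^m − 1, 2^m − 1 − 2m, 3]]` (`a = b = 1`), `pqrm_31_21_3`, `pqrm_63_36_3` (`1,2,6`),
  `pqrm_63_21_7` (`2,2,6`), `pqrm_127_71_7` (`2,2,7`), `pqrm_255_183_7` (`2,2,8`), `pqrm_255_71_15` (`3,3,8`);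
* Q4: `pqrm_flatFin_hasOptimalRadius` — radius `2^{min(a,b)} − 1` attained and optimal.

TIER: CERTIFIED (KERNEL-std); 0 named facts, 0 sorry, no `native_decide`; axioms ⊆ {propext, Classical.choice, Quot.sound}.
HONEST FRAMING: punctured quantum Reed–Muller codes are IN PRINT (e.g. Hu–Liang–Calderbank 2022, arXiv:2204.13176 Example 1 =
`[[15,1,3]]` = `PQRM(4;1,2)`, chunk p0005); the general two-parameter parameter line is elementary (MacWilliams–Sloane Ch. 13
Thms 3–4 and §5) and is assembled here from tree theorems; whether it is tabulated in print is not asserted; no novelty word.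

References: [MacWilliamsSloane1977] Ch. 13 §3 Thms 3–4 (chunks p0306–p0309), §5; [LandahlCesare2013] §6 (chunk p0012);
[AndersonDuclosCianciPoulin2014] p. 3 (chunk p0003); [Gottesman1997] §2.3 (radius ⌊(d−1)/2⌋).
-/

namespace Summit.Ventures.QEC.PQRM

open Matrix Finset Literature.InformationTheory.QuantumCodes Literature.InformationTheory.QuantumCodes.QRM
open Literature.InformationTheory.Coding Summit.Ventures.QEC.HGP

variable {m : ℕ}

/-- **The punctured quantum Reed–Muller code `PQRM(m; a, b)`** (`a + b < m`): `X`-checks `Ḡ(a,m)`, `Z`-checks `Ḡ(b,m)` on the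
nonzero points. (definition) [cite: LandahlCesare2013, §6 Def. 2 and the shortened codes (chunk p0012 L52-90)] -/
def pqrm (m a b : ℕ) (h : a + b < m) : CSSCode (MonoPos m a) (MonoPos m b) (Pt m) :=
  CSSCode.ofMatrices (shortGenMatrix m a) (shortGenMatrix m b) (shortGenMatrix_mul_transpose h)

/-- `H^X = Ḡ(a,m)`. [cite: LandahlCesare2013, §6 (chunk p0012 L67-79)] -/
theorem pqrm_HX {a b : ℕ} (h : a + b < m) : (pqrm m a b h).HX = shortGenMatrix m a := rfl

/-- `H^Z = Ḡ(b,m)`. [cite: LandahlCesare2013, §6 (chunk p0012 L67-79)] -/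
theorem pqrm_HZ {a b : ℕ} (h : a + b < m) : (pqrm m a b h).HZ = shortGenMatrix m b := rfl

/-- `A_a + A_b ≤ 2^m` for `a + b < m` (`A_b ≤ A_{m−a−1}` and `A_a + A_{m−a−1} = 2^m`). [cite: MacWilliamsSloane1977, Ch. 13 §3 Thm. 4 (chunk p0309)] -/
theorem rmRows_add_rmRows_le {a b : ℕ} (h : a + b < m) : rmRows m a + rmRows m b ≤ 2 ^ m := by
  have hs := ReedMuller.sum_range_choose_add (r := a) (s := m - a - 1) (m := m) (by omega)
  have hmono : rmRows m b ≤ ∑ i ∈ range (m - a - 1 + 1), m.choose i :=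
    sum_le_sum_of_subset (range_subset_range.2 (by omega))
  rw [rmRows]; omega

/-- **`k = 2^m + 1 − A_a − A_b`** (`k = (2^m − 1) − (A_a − 1) − (A_b − 1)`). [cite: LandahlCesare2013, §6 (chunk p0012 L69-80)] -/
theorem pqrm_k {a b : ℕ} (h : a + b < m) : (pqrm m a b h).k = 2 ^ m + 1 - rmRows m a - rmRows m b := by
  rw [CSSCode.k_eq, card_pt, pqrm_HX, pqrm_HZ]
  have ha := rank_shortGenMatrix m a
  have hb := rank_shortGenMatrix m b
  have hle := rmRows_add_rmRows_le h
  have h1 : 1 ≤ 2 ^ m := Nat.one_le_two_pow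
  rw [rmRows] at hle ⊢; rw [rmRows] at hle ⊢
  omega

/-- `k ≥ 1`. [cite: LandahlCesare2013, §6 (chunk p0012 L80)] -/
theorem pqrm_k_pos {a b : ℕ} (h : a + b < m) : 0 < (pqrm m a b h).k := by
  rw [pqrm_k]
  have := rmRows_add_rmRows_le h
  omega

/-- The row spaces of the shortened generator matrices grow with the degree. [cite: MacWilliamsSloane1977, Ch. 13 §3 (chunk p0306: ℛ(r,m) ⊆ ℛ(r+1,m))] -/
theorem rowSpace_shortGenMatrix_mono {b s : ℕ} (hbs : b ≤ s) :
    rowSpace (shortGenMatrix m b) ≤ rowSpace (shortGenMatrix m s) := by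
  intro v hv
  obtain ⟨g, hg, hg0, hgv⟩ := (mem_rowSpace_shortGenMatrix_iff v).1 hv
  exact (mem_rowSpace_shortGenMatrix_iff v).2 ⟨g, ReedMuller.code_mono hbs hg, hg0, hgv⟩

/-- **`d_Z = 2^{a+1} − 1`**: every nonzero word of `ker Ḡ(a,m)` (the punctured code `ℛ(m−a−1,m)^*`) has weight `≥ 2^{a+1} − 1`,
and the weight-`(2^{a+1} − 1)` logical of `QRM.exists_logical` lies outside `rs Ḡ(m−a−1,m) ⊇ rs Ḡ(b,m)`.
[cite: MacWilliamsSloane1977, Ch. 13 §3 Thm. 3 (chunk p0308) and §5] -/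
theorem pqrm_dZ {a b : ℕ} (h : a + b < m) : (pqrm m a b h).dZ = 2 ^ (a + 1) - 1 := by
  obtain ⟨v, hv, hv', hwt⟩ := exists_logical (m := m) (r := a) (s := m - a - 1) (by omega)
  refine (pqrm m a b h).dZ_eq_of_witness hv (fun hmem => hv' (rowSpace_shortGenMatrix_mono (by omega) hmem)) hwt ?_
  intro w hw hw'
  have hw0 : w ≠ 0 := fun h0 => hw' (h0 ▸ Submodule.zero_mem _)
  have := minDist_le_hammingNorm ((mem_pcCode_iff _ _).2 hw) hw0
  rw [pqrm_HX, minDist_pcCode_shortGenMatrix (show a < m by omega)] at this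
  exact_mod_cast this

/-- **`d_X = 2^{b+1} − 1`** (the mirror statement). [cite: MacWilliamsSloane1977, Ch. 13 §3 Thm. 3 (chunk p0308) and §5] -/
theorem pqrm_dX {a b : ℕ} (h : a + b < m) : (pqrm m a b h).dX = 2 ^ (b + 1) - 1 := by
  obtain ⟨v, hv, hv', hwt⟩ := exists_logical (m := m) (r := b) (s := m - b - 1) (by omega)
  refine (pqrm m a b h).dX_eq_of_witness hv (fun hmem => hv' (rowSpace_shortGenMatrix_mono (by omega) hmem)) hwt ?_
  intro w hw hw'
  have hw0 : w ≠ 0 := fun h0 => hw' (h0 ▸ Submodule.zero_mem _)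
  have := minDist_le_hammingNorm ((mem_pcCode_iff _ _).2 hw) hw0
  rw [pqrm_HZ, minDist_pcCode_shortGenMatrix (show b < m by omega)] at this
  exact_mod_cast this

/-- ★ **The punctured quantum Reed–Muller family: exact parameters** `[[2^m − 1, 2^m + 1 − A_a − A_b, 2^{min(a,b)+1} − 1]]` for every
`a + b < m`. [cite: MacWilliamsSloane1977, Ch. 13 §3 Thms. 3-4 (chunks p0308-p0309)] [cite: LandahlCesare2013, §6 (chunk p0012)] -/
theorem pqrm_isCode {a b : ℕ} (h : a + b < m) :
    (pqrm m a b h).IsCode (2 ^ m - 1) (2 ^ m + 1 - rmRows m a - rmRows m b) (2 ^ (min a b + 1) - 1) := by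
  have hmin : min (2 ^ (b + 1) - 1) (2 ^ (a + 1) - 1) = 2 ^ (min a b + 1) - 1 := by
    rcases le_total a b with hab | hab
    · have : 2 ^ (a + 1) ≤ 2 ^ (b + 1) := Nat.pow_le_pow_right (by norm_num) (by omega)
      rw [min_eq_right (by omega), min_eq_left hab]
    · have : 2 ^ (b + 1) ≤ 2 ^ (a + 1) := Nat.pow_le_pow_right (by norm_num) (by omega)
      rw [min_eq_left (by omega), min_eq_right hab]
  have := (pqrm m a b h).isCode_of_dX_dZ (pqrm_k_pos h) (pqrm_dX h) (pqrm_dZ h)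
  rwa [card_pt, pqrm_k, hmin] at this

/-- Parameters with caller-supplied numerals. [cite: MacWilliamsSloane1977, Ch. 13 §3 (chunks p0306-p0309)] -/
theorem pqrm_isCode_of_eq {a b n k d : ℕ} (h : a + b < m) (hn : 2 ^ m - 1 = n) (hk : 2 ^ m + 1 - rmRows m a - rmRows m b = k)
    (hd : 2 ^ (min a b + 1) - 1 = d) : (pqrm m a b h).IsCode n k d := by
  rw [← hn, ← hk, ← hd]; exact pqrm_isCode h

/-! ## Members -/

/-- `A(m,1) = m + 1`. [cite: MacWilliamsSloane1977, Ch. 13 §3 (chunk p0306)] -/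
theorem rmRows_one (m : ℕ) : rmRows m 1 = m + 1 := by
  rw [rmRows, sum_range_succ, sum_range_one, Nat.choose_zero_right, Nat.choose_one_right, add_comm]

/-- ★ **The quantum Hamming family as `PQRM(m; 1, 1)`**: `[[2^m − 1, 2^m − 1 − 2m, 3]]` for every `m ≥ 3`.
[cite: MacWilliamsSloane1977, Ch. 13 §3 (ℛ(m−2,m) = extended Hamming code, chunk p0309)] -/
theorem pqrm_hamming (hm : 3 ≤ m) : (pqrm m 1 1 (by omega)).IsCode (2 ^ m - 1) (2 ^ m - 1 - 2 * m) 3 :=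
  pqrm_isCode_of_eq _ rfl (by rw [rmRows_one]; omega) (by norm_num)

/-- `A(6,2) = 22`. [cite: MacWilliamsSloane1977, Ch. 13 §3 (chunk p0306)] -/
theorem rmRows_6_2 : rmRows 6 2 = 22 := by decide
/-- `A(7,2) = 29`. [cite: MacWilliamsSloane1977, Ch. 13 §3 (chunk p0306)] -/
theorem rmRows_7_2 : rmRows 7 2 = 29 := by decide
/-- `A(8,2) = 37`. [cite: MacWilliamsSloane1977, Ch. 13 §3 (chunk p0306)] -/
theorem rmRows_8_2 : rmRows 8 2 = 37 := by decide
/-- `A(8,3) = 93`. [cite: MacWilliamsSloane1977, Ch. 13 §3 (chunk p0306)] -/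
theorem rmRows_8_3 : rmRows 8 3 = 93 := by decide
/-- `A(6,1) = 7`. [cite: MacWilliamsSloane1977, Ch. 13 §3 (chunk p0306)] -/
theorem rmRows_6_1 : rmRows 6 1 = 7 := by decide

/-- `PQRM(5;1,1) = [[31, 21, 3]]`. [cite: MacWilliamsSloane1977, Ch. 13 §3 (chunk p0309)] -/
theorem pqrm_31_21_3 : (pqrm 5 1 1 (by norm_num)).IsCode 31 21 3 := pqrm_hamming (m := 5) (by norm_num)

/-- `PQRM(6;1,2) = [[63, 36, 3]]` (`A_1 = 7`, `A_2 = 22`). [cite: MacWilliamsSloane1977, Ch. 13 §3 (chunks p0306-p0309)] -/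
theorem pqrm_63_36_3 : (pqrm 6 1 2 (by norm_num)).IsCode 63 36 3 :=
  pqrm_isCode_of_eq _ rfl (by rw [rmRows_6_1, rmRows_6_2]; norm_num) (by norm_num)

/-- `PQRM(6;2,2) = [[63, 21, 7]]`. [cite: MacWilliamsSloane1977, Ch. 13 §3 (chunks p0306-p0309)] -/
theorem pqrm_63_21_7 : (pqrm 6 2 2 (by norm_num)).IsCode 63 21 7 :=
  pqrm_isCode_of_eq _ rfl (by rw [rmRows_6_2]; norm_num) (by norm_num)

/-- `PQRM(7;2,2) = [[127, 71, 7]]`. [cite: MacWilliamsSloane1977, Ch. 13 §3 (chunks p0306-p0309)] -/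
theorem pqrm_127_71_7 : (pqrm 7 2 2 (by norm_num)).IsCode 127 71 7 :=
  pqrm_isCode_of_eq _ rfl (by rw [rmRows_7_2]; norm_num) (by norm_num)

/-- `PQRM(8;2,2) = [[255, 183, 7]]`. [cite: MacWilliamsSloane1977, Ch. 13 §3 (chunks p0306-p0309)] -/
theorem pqrm_255_183_7 : (pqrm 8 2 2 (by norm_num)).IsCode 255 183 7 :=
  pqrm_isCode_of_eq _ rfl (by rw [rmRows_8_2]; norm_num) (by norm_num)

/-- `PQRM(8;3,3) = [[255, 71, 15]]`. [cite: MacWilliamsSloane1977, Ch. 13 §3 (chunks p0306-p0309)] -/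
theorem pqrm_255_71_15 : (pqrm 8 3 3 (by norm_num)).IsCode 255 71 15 :=
  pqrm_isCode_of_eq _ rfl (by rw [rmRows_8_3]; norm_num) (by norm_num)

/-! ## Q4: correction radius -/

/-- `⌊(2^{c+1} − 1 − 1)/2⌋ = 2^c − 1`. [folklore] -/
private theorem two_pow_succ_sub_two_div_two' (c : ℕ) : (2 ^ (c + 1) - 1 - 1) / 2 = 2 ^ c - 1 := by
  have := Nat.one_le_two_pow (n := c)
  rw [pow_succ]; omega

/-- ★ **Q4 — radius `2^{min(a,b)} − 1` attained and optimal** for every `PQRM(m;a,b)`, `a + b < m` (flattened to `Fin (2^m − 1)`).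
[cite: Gottesman1997, §2.3 (chunk p0014 L3: distance 2t+1 corrects t errors)] -/
theorem pqrm_flatFin_hasOptimalRadius {a b : ℕ} (h : a + b < m) :
    (pqrm m a b h).flatFin.HasOptimalRadius (2 ^ min a b - 1) :=
  (pqrm_isCode h).flatFin_hasOptimalRadius (two_pow_succ_sub_two_div_two' _)

end Summit.Ventures.QEC.PQRM
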